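import Literature.Geometry.Lorentzian.BogovskiiKernelSecondOrder
import HarnessLib

/-!
# The Bogovskiĭ-type kernel for the symmetric divergence: weak identity (Mao–Oh–Tao's Lemma 2.3, (T2))

(trunk G08 = T-LORENTZ; family `gr`; namespace `Literature.Geometry.Lorentzian.MaoOhTao`.)

Mao–Oh–Tao (arXiv:2308.13031), Lemma 2.3, second part (p. 8): with `w_y(z) = ∫_{|z|}^∞ η(r z/|z| + y) r² dr`
(`bogovskiiWeight`), `V^i = w_y zⁱ/|z|³` and `K^{ij} = w_y zⁱzʲ/|z|³`, the operator
`(T f)^{ij}(x) = ∫ (Ψ_η)^{ij}_k(x, y) f^k(y) dy` with the kernel (in divergence form)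

  `(Ψ_η)^{ij}_k(z + y, y) = ± ½ (Vⁱ δ^j_k + δ^i_k Vʲ) + ½ ∂_{z^m}(δ^j_k K^{im} + δ^i_k K^{jm}) − ∂_{z^k} K^{ij}`

is claimed to satisfy (T1), (T2) (`∂_i (T f)^{ij} = f^j` under `∫ f·(e, Y)† = 0`; the paper defers the proof to
[IseOh]).  **Sign.** The printed sign of the first term is `−`; pairing against test functions with the identities of
`BogovskiiDoubleDivergence.lean` (`div V = (∫η) δ₀ − η(· + y)`) and `BogovskiiKernelSecondOrder.lean`
(`∂_i∂_m K^{im} = (∫η) δ₀ − 4η(· + y) − z·∇η(· + y)`) one finds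
`∂_i Ψ^{ij}_k = ∓… `: with the `−` sign the Dirac masses cancel and a singular term `−∂_k Vʲ` survives, whereas with
the `+` sign

  `∂_{zⁱ} (Ψ_η)^{ij}_k = (∫η) δ^j_k δ₀ + δ^j_k (−(5/2) η − ½ z·∇η)(z + y) + ½ ∂_{z^k}(zʲ η(z + y))`,

whose smooth part integrates to zero against `f^k(y) dy` exactly under the six moment conditions of (T2).  This file
proves the `+`-sign identity in weak form, per `y` (`bogovskiiT_weak`): for `φ ∈ C²_c(ℝ³)` and indices `j, k`,

  `δ_{jk} (½ Σ_i ∫ Vⁱ ∂ᵢφ − ½ Σ_{i,m} ∫ K^{im} ∂ₘ∂ᵢφ) + ½ ∫ Vʲ ∂ₖφ − ½ Σ_m ∫ V^m zʲ ∂ₘ∂ₖφ + Σ_i ∫ Vⁱ zʲ ∂ᵢ∂ₖφ`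
  `= −δ_{jk} φ(0) ∫η + δ_{jk} ∫ ((5/2) η(z + y) + ½ z·∇η(z + y)) φ(z) dz + ½ ∫ η(z + y) zʲ ∂ₖφ(z) dz`,

the left side being `Σ_i ⟨(Ψ_η)^{ij}_k(· + y, y), ∂ᵢφ⟩` with the derivatives `∂_m`, `∂_k` of the kernel moved onto the
test function (and `K^{ij} ∂ₖ∂ᵢφ = Vⁱ zʲ ∂ᵢ∂ₖφ` by the symmetry of second derivatives).  Ingredients:
`sum_integral_bogovskiiV_pd_eq` (`Σ_i ∫ Vⁱ ∂ᵢφ = −φ(0)∫η + ∫ η(z + y) φ`) and `sum_integral_bogovskiiV_coord_pd_eq`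
(`Σ_m ∫ V^m zʲ ∂ₘg = ∫ η(z + y) zʲ g − ∫ Vʲ g`).

Then the density is integrated in: `integral_mul_bogovskiiT_remainder_eq`, `sum_sum_integral_mul_bogovskiiT_remainder_eq`
(the smooth remainder pairs to zero against `F^k(y) dy` under the six Killing moment conditions `∫ F^k = 0`,
`∫ y_m F^j = ∫ y_j F^m` — integration by parts `∫ η ∂ₖψⱼ = −∫ ∂ₖη ψⱼ` and symmetry), and
`sum_sum_integral_mul_bogovskiiT_weak_eq`: `Σ_{j,k} ∫ F^k(y) Σ_i ⟨Ψ^{ij}_k(· + y, y), ∂ᵢψⱼ(· + y)⟩ dy = −(∫η) Σ_j ∫ F^j ψ_j`,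
the weak form of (T2) with the density integrated (the operator-level form, with the `y`-integral inside, needs one
more Fubini as in `BogovskiiOperator.lean`).

Everything is proved; no definitions, no named facts.

## References

* Y. Mao, S.-J. Oh, T. Tao, arXiv:2308.13031 (2023), Lemma 2.3 and the display following (2.3), p. 8
  (key `MaoOhTao2023`); the proof of (T2) is deferred there to P. Isett, S.-J. Oh, *On nonperiodic Euler flows with
  Hölder regularity*, Arch. Ration. Mech. Anal. 221 (2016).
-/

noncomputable section

open scoped RealInnerProductSpace Topology ContDiff
open Filter MeasureTheory Set Metric Function

namespace Literature.Geometry.Lorentzian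

namespace MaoOhTao

variable {η : E3 → ℝ} {R : ℝ} {φ : E3 → ℝ}

/-- `|zᵢ| ≤ |z|`. [folklore] -/
private theorem abs_coord_le_norm (z : E3) (i : Fin 3) : |z i| ≤ ‖z‖ := by
  simpa using PiLp.norm_apply_le z i

/-- The vector kernel against a continuous compactly supported function is integrable:
`z ↦ w_y zᵢ |z|⁻³ g(z) ∈ L¹`. [folklore] -/
theorem integrable_bogovskiiV_mul (hη : Continuous η) (hR : ∀ z : E3, R < ‖z‖ → η z = 0) {g : E3 → ℝ}
    (hg : Continuous g) (hgc : HasCompactSupport g) (y : E3) (i : Fin 3) :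
    Integrable fun z : E3 ↦ bogovskiiWeight η y ‖z‖ (‖z‖⁻¹ • z) * (z i * (‖z‖ ^ 3)⁻¹) * g z := by
  obtain ⟨W, hW⟩ := exists_abs_bogovskiiWeight_norm_le hη hR y
  obtain ⟨M, hM⟩ := hg.bounded_above_of_compact_support hgc
  have hint : Integrable fun z : E3 ↦
      bogovskiiWeight η y ‖z‖ (‖z‖⁻¹ • z) * ((‖z‖ ^ 3)⁻¹ * (z i * g z)) := by
    refine integrable_weight_mul_of_le (continuousOn_bogovskiiWeight_norm hη hR y) hW
      ((EuclideanSpace.proj (𝕜 := ℝ) i).continuous.mul hg) hgc.mul_left (C := M) fun z ↦ ?_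
    rw [abs_mul, mul_comm M]
    exact mul_le_mul (abs_coord_le_norm z i) ((Real.norm_eq_abs _).symm.le.trans (hM z)) (abs_nonneg _)
      (norm_nonneg _)
  exact hint.congr (Eventually.of_forall fun z ↦ by simp only; ring)

/-- **`div V = (∫η) δ₀ − η(· + y)` in components**: `Σ_i ∫ w_y zᵢ|z|⁻³ ∂ᵢφ = −φ(0) ∫η + ∫ η(z + y) φ(z) dz` for
`φ ∈ C¹_c`. [cite: MaoOhTao2023, Lemma 2.3 (proof)] -/
theorem sum_integral_bogovskiiV_pd_eq (hη : Continuous η) (hR : ∀ z : E3, R < ‖z‖ → η z = 0)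
    (hφ : ContDiff ℝ 1 φ) (hφc : HasCompactSupport φ) (y : E3) :
    ∑ i, ∫ z : E3, bogovskiiWeight η y ‖z‖ (‖z‖⁻¹ • z) * (z i * (‖z‖ ^ 3)⁻¹) * pd i φ z =
      -(φ 0 * ∫ z : E3, η z) + ∫ z : E3, η (z + y) * φ z := by
  have hpc : ∀ i, Continuous (pd i φ) := fun i ↦ (hφ.continuous_fderiv one_ne_zero).clm_apply continuous_const
  rw [← integral_finsetSum _ fun i _ ↦ integrable_bogovskiiV_mul hη hR (hpc i) (hasCompactSupport_pd hφc i) y i,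
    ← integral_bogovskiiWeight_fderiv_apply_self_eq hη hR hφ hφc y]
  refine integral_congr_ae (ae_of_all _ fun z ↦ ?_)
  simp only
  rw [fderiv_apply_self_eq_sum, Finset.mul_sum, Finset.mul_sum]
  exact Finset.sum_congr rfl fun i _ ↦ by ring

/-- **`Σ_m ∫ V^m zʲ ∂ₘg = ∫ η(z + y) zʲ g − ∫ Vʲ g`** for `g ∈ C¹_c` (the previous identity for the test function
`zʲ g`, which vanishes at the origin, and Leibniz). [cite: MaoOhTao2023, Lemma 2.3 (proof)] -/
theorem sum_integral_bogovskiiV_coord_pd_eq (hη : Continuous η) (hR : ∀ z : E3, R < ‖z‖ → η z = 0)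
    {g : E3 → ℝ} (hg : ContDiff ℝ 1 g) (hgc : HasCompactSupport g) (y : E3) (j : Fin 3) :
    ∑ m, ∫ z : E3, bogovskiiWeight η y ‖z‖ (‖z‖⁻¹ • z) * (z m * (‖z‖ ^ 3)⁻¹) * (z j * pd m g z) =
      (∫ z : E3, η (z + y) * (z j * g z)) -
        ∫ z : E3, bogovskiiWeight η y ‖z‖ (‖z‖⁻¹ • z) * (z j * (‖z‖ ^ 3)⁻¹) * g z := by
  set h : E3 → ℝ := fun z ↦ z j * g z with hh
  have hhd : ContDiff ℝ 1 h := (EuclideanSpace.proj (𝕜 := ℝ) j).contDiff.mul hg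
  have hhc : HasCompactSupport h := hgc.mul_left
  have hgd : ∀ z, DifferentiableAt ℝ g z := fun z ↦ (hg.differentiable one_ne_zero z)
  have key := sum_integral_bogovskiiV_pd_eq hη hR hhd hhc y
  have h0 : h 0 = 0 := by simp [hh]
  rw [h0, zero_mul, neg_zero, zero_add] at key
  -- Leibniz: `∂ₘ(zʲ g) = δ_{jm} g + zʲ ∂ₘ g`
  have hpd : ∀ m z, pd m h z = (if j = m then 1 else 0) * g z + z j * pd m g z := fun m z ↦
    pd_coord_mul (x := z) (m := m) j (hgd z)
  have hgc' : Continuous g := hg.continuous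
  have hpc : ∀ m, Continuous (pd m g) := fun m ↦ (hg.continuous_fderiv one_ne_zero).clm_apply continuous_const
  have I1 : ∀ m, Integrable fun z : E3 ↦
      bogovskiiWeight η y ‖z‖ (‖z‖⁻¹ • z) * (z m * (‖z‖ ^ 3)⁻¹) * ((if j = m then 1 else 0) * g z) := fun m ↦
    integrable_bogovskiiV_mul hη hR (continuous_const.mul hgc') (hgc.mul_left) y m
  have I2 : ∀ m, Integrable fun z : E3 ↦
      bogovskiiWeight η y ‖z‖ (‖z‖⁻¹ • z) * (z m * (‖z‖ ^ 3)⁻¹) * (z j * pd m g z) := fun m ↦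
    integrable_bogovskiiV_mul hη hR ((EuclideanSpace.proj (𝕜 := ℝ) j).continuous.mul (hpc m))
      ((hasCompactSupport_pd hgc m).mul_left) y m
  have hsplit : ∀ m, ∫ z : E3, bogovskiiWeight η y ‖z‖ (‖z‖⁻¹ • z) * (z m * (‖z‖ ^ 3)⁻¹) * pd m h z =
      (∫ z : E3, bogovskiiWeight η y ‖z‖ (‖z‖⁻¹ • z) * (z m * (‖z‖ ^ 3)⁻¹) * ((if j = m then 1 else 0) * g z)) +
        ∫ z : E3, bogovskiiWeight η y ‖z‖ (‖z‖⁻¹ • z) * (z m * (‖z‖ ^ 3)⁻¹) * (z j * pd m g z) := by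
    intro m
    rw [← integral_add (I1 m) (I2 m)]
    refine integral_congr_ae (ae_of_all _ fun z ↦ ?_)
    simp only
    rw [hpd m z]
    ring
  simp only [hsplit, Finset.sum_add_distrib] at key
  -- the Kronecker sum is `∫ Vʲ g`
  have hδ : ∑ m, ∫ z : E3, bogovskiiWeight η y ‖z‖ (‖z‖⁻¹ • z) * (z m * (‖z‖ ^ 3)⁻¹) *
      ((if j = m then 1 else 0) * g z) =
      ∫ z : E3, bogovskiiWeight η y ‖z‖ (‖z‖⁻¹ • z) * (z j * (‖z‖ ^ 3)⁻¹) * g z := by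
    rw [Finset.sum_eq_single j]
    · simp
    · intro m _ hm
      simp [Ne.symm hm]
    · simp
  rw [hδ] at key
  linarith

/-- **(T2) for the Bogovskiĭ-type vector kernel, weak form (per `y`).** For `η ∈ C¹_c`, `φ ∈ C²_c(ℝ³)` and indices
`j, k` (with `V^i = w_y zⁱ/|z|³`, `K^{im} = V^i z^m`):
`δ_{jk}(½ Σ_i ∫ Vⁱ∂ᵢφ − ½ Σ_{i,m} ∫ K^{im}∂ₘ∂ᵢφ) + ½ ∫ Vʲ∂ₖφ − ½ Σ_m ∫ V^m zʲ ∂ₘ∂ₖφ + Σ_i ∫ Vⁱ zʲ ∂ᵢ∂ₖφ`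
`= −δ_{jk} φ(0)∫η + δ_{jk} ∫ ((5/2)η(z + y) + ½ z·∇η(z + y)) φ + ½ ∫ η(z + y) zʲ ∂ₖφ` — i.e.
`Σ_i ⟨(Ψ_η)^{ij}_k(· + y, y), ∂ᵢφ⟩ = −⟨(∫η) δ^j_k δ₀ + (smooth), φ⟩` for the `+`-sign kernel of the module docstring.
[cite: MaoOhTao2023, Lemma 2.3 (T2)] -/
theorem bogovskiiT_weak (hη : ContDiff ℝ 1 η) (hR : ∀ z : E3, R < ‖z‖ → η z = 0) (hφ : ContDiff ℝ 2 φ)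
    (hφc : HasCompactSupport φ) (y : E3) (j k : Fin 3) :
    (if j = k then (1 : ℝ) else 0) *
        ((1 / 2 : ℝ) * (∑ i, ∫ z : E3, bogovskiiWeight η y ‖z‖ (‖z‖⁻¹ • z) * (z i * (‖z‖ ^ 3)⁻¹) * pd i φ z) -
          (1 / 2 : ℝ) * ∑ i, ∑ m, ∫ z : E3,
            bogovskiiWeight η y ‖z‖ (‖z‖⁻¹ • z) * (z i * (z m * (‖z‖ ^ 3)⁻¹)) * pd m (pd i φ) z) +
      (1 / 2 : ℝ) * (∫ z : E3, bogovskiiWeight η y ‖z‖ (‖z‖⁻¹ • z) * (z j * (‖z‖ ^ 3)⁻¹) * pd k φ z) -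
      (1 / 2 : ℝ) * (∑ m, ∫ z : E3,
        bogovskiiWeight η y ‖z‖ (‖z‖⁻¹ • z) * (z m * (‖z‖ ^ 3)⁻¹) * (z j * pd m (pd k φ) z)) +
      ∑ i, ∫ z : E3, bogovskiiWeight η y ‖z‖ (‖z‖⁻¹ • z) * (z i * (‖z‖ ^ 3)⁻¹) * (z j * pd i (pd k φ) z) =
    -((if j = k then (1 : ℝ) else 0) * (φ 0 * ∫ z : E3, η z)) +
      (if j = k then (1 : ℝ) else 0) *
        (∫ z : E3, ((5 / 2 : ℝ) * η (z + y) + (1 / 2 : ℝ) * ∑ m, z m * pd m η (z + y)) * φ z) +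
      (1 / 2 : ℝ) * ∫ z : E3, η (z + y) * (z j * pd k φ z) := by
  have hηc : Continuous η := hη.continuous
  have hφ1 : ContDiff ℝ 1 φ := hφ.of_le one_le_two
  have hg : ContDiff ℝ 1 (pd k φ) := contDiff_pd (n := 1) hφ k
  have hgc : HasCompactSupport (pd k φ) := hasCompactSupport_pd hφc k
  -- the three ingredients
  have A1 := sum_integral_bogovskiiV_pd_eq hηc hR hφ1 hφc y
  have B1 := sum_sum_integral_bogovskiiKernel_pd_pd_eq hη hR hφ hφc y
  have L := sum_integral_bogovskiiV_coord_pd_eq hηc hR hg hgc y j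
  rw [A1, B1, L]
  -- combine `(5/2) ∫ η̃ φ + ½ ∫ (z·∇η̃) φ`
  obtain ⟨Rφ, hRφ⟩ := hφc.isCompact.isBounded.subset_closedBall 0
  have hs : Continuous fun z : E3 ↦ ∑ m, z m * pd m η (z + y) :=
    continuous_finsetSum _ fun m _ ↦ (EuclideanSpace.proj (𝕜 := ℝ) m).continuous.mul
      (((hη.continuous_fderiv one_ne_zero).clm_apply continuous_const).comp (continuous_id.add continuous_const))
  have I1 : Integrable fun z : E3 ↦ (5 / 2 : ℝ) * (η (z + y) * φ z) :=
    (((hηc.comp (continuous_id.add continuous_const)).mul hφ.continuous).integrable_of_hasCompactSupport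
      hφc.mul_left).const_mul _
  have I2 : Integrable fun z : E3 ↦ (1 / 2 : ℝ) * ((∑ m, z m * pd m η (z + y)) * φ z) :=
    ((hs.mul hφ.continuous).integrable_of_hasCompactSupport hφc.mul_left).const_mul _
  have hcomb : ∫ z : E3, ((5 / 2 : ℝ) * η (z + y) + (1 / 2 : ℝ) * ∑ m, z m * pd m η (z + y)) * φ z =
      (5 / 2 : ℝ) * (∫ z : E3, η (z + y) * φ z) + (1 / 2 : ℝ) * ∫ z : E3, (∑ m, z m * pd m η (z + y)) * φ z := by
    rw [← integral_const_mul, ← integral_const_mul, ← integral_add I1 I2]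
    refine integral_congr_ae (ae_of_all _ fun z ↦ ?_)
    simp only
    ring
  rw [hcomb]
  ring


/-! ### The smooth remainder cancels under the Killing moment conditions -/

section Remainder

variable {ψ : E3 → ℝ}

/-- Pairing an affine function with a density of zero mass: `∫ f (α + Σ_m β_m y_m) = Σ_m β_m ∫ y_m f`. [folklore] -/
theorem integral_mul_affine_eq {f : E3 → ℝ} (hf : Continuous f) (hfc : HasCompactSupport f)
    (hf0 : ∫ y : E3, f y = 0) (α : ℝ) (β : Fin 3 → ℝ) :
    ∫ y : E3, f y * (α + ∑ m, β m * y m) = ∑ m, β m * ∫ y : E3, y m * f y := by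
  have I0 : Integrable fun y : E3 ↦ f y * α := (hf.integrable_of_hasCompactSupport hfc).mul_const α
  have Im : ∀ m, Integrable fun y : E3 ↦ β m * (y m * f y) := fun m ↦
    (((EuclideanSpace.proj (𝕜 := ℝ) m).continuous.mul hf).integrable_of_hasCompactSupport hfc.mul_left).const_mul _
  have e : (fun y : E3 ↦ f y * (α + ∑ m, β m * y m)) = fun y ↦ f y * α + ∑ m, β m * (y m * f y) := by
    funext y
    rw [mul_add, Finset.mul_sum]
    congr 1
    exact Finset.sum_congr rfl fun m _ ↦ by ring
  rw [e, integral_add I0 (integrable_finsetSum _ fun m _ ↦ Im m), integral_finsetSum _ fun m _ ↦ Im m,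
    integral_mul_const, hf0, zero_mul, zero_add]
  exact Finset.sum_congr rfl fun m _ ↦ integral_const_mul _ _

/-- Translating the second remainder term back to `x = z + y`:
`∫ ((5/2)η(z + y) + ½ z·∇η(z + y)) ψ(z + y) dz = (5/2)∫ηψ + ½Σ_m ∫ x_m ∂_mη ψ − ½Σ_m y_m ∫ ∂_mη ψ`. [folklore] -/
theorem integral_remainder₂_eq (hη : ContDiff ℝ 1 η) (hψ : Continuous ψ) (hψc : HasCompactSupport ψ) (y : E3) :
    ∫ z : E3, ((5 / 2 : ℝ) * η (z + y) + (1 / 2 : ℝ) * ∑ m, z m * pd m η (z + y)) * ψ (z + y) =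
      (5 / 2 : ℝ) * (∫ x : E3, η x * ψ x) + (1 / 2 : ℝ) * (∑ m, ∫ x : E3, x m * (pd m η x * ψ x)) -
        (1 / 2 : ℝ) * ∑ m, y m * ∫ x : E3, pd m η x * ψ x := by
  have hηc : Continuous η := hη.continuous
  have hpc : ∀ m, Continuous (pd m η) := fun m ↦ (hη.continuous_fderiv one_ne_zero).clm_apply continuous_const
  set H : E3 → ℝ := fun x ↦ (5 / 2 : ℝ) * (η x * ψ x) +
    ∑ m, ((1 / 2 : ℝ) * (x m * (pd m η x * ψ x)) - (1 / 2 : ℝ) * y m * (pd m η x * ψ x)) with hH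
  have h1 : ∫ z : E3, ((5 / 2 : ℝ) * η (z + y) + (1 / 2 : ℝ) * ∑ m, z m * pd m η (z + y)) * ψ (z + y) =
      ∫ x : E3, H x := by
    rw [← integral_add_right_eq_self H y]
    refine integral_congr_ae (ae_of_all _ fun z ↦ ?_)
    simp only [hH, PiLp.add_apply]
    rw [add_mul, Finset.mul_sum, Finset.sum_mul]
    congr 1
    · ring
    · exact Finset.sum_congr rfl fun m _ ↦ by ring
  rw [h1]
  have I1 : Integrable fun x : E3 ↦ (5 / 2 : ℝ) * (η x * ψ x) :=
    ((hηc.mul hψ).integrable_of_hasCompactSupport hψc.mul_left).const_mul _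
  have I2 : ∀ m, Integrable fun x : E3 ↦ (1 / 2 : ℝ) * (x m * (pd m η x * ψ x)) := fun m ↦
    (((EuclideanSpace.proj (𝕜 := ℝ) m).continuous.mul ((hpc m).mul hψ)).integrable_of_hasCompactSupport
      (hψc.mul_left.mul_left)).const_mul _
  have I3 : ∀ m, Integrable fun x : E3 ↦ (1 / 2 : ℝ) * y m * (pd m η x * ψ x) := fun m ↦
    (((hpc m).mul hψ).integrable_of_hasCompactSupport hψc.mul_left).const_mul _
  have I23 : ∀ m, Integrable fun x : E3 ↦
      (1 / 2 : ℝ) * (x m * (pd m η x * ψ x)) - (1 / 2 : ℝ) * y m * (pd m η x * ψ x) := fun m ↦ (I2 m).sub (I3 m)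
  simp only [hH]
  rw [integral_add I1 (integrable_finsetSum _ fun m _ ↦ I23 m), integral_finsetSum _ fun m _ ↦ I23 m,
    Finset.sum_congr rfl fun m _ ↦ integral_sub (I2 m) (I3 m)]
  simp only [integral_const_mul, Finset.sum_sub_distrib, Finset.mul_sum]
  ring

/-- Translating the third remainder term back to `x = z + y`:
`∫ η(z + y) zⱼ ∂ₖψ(z + y) dz = ∫ η xⱼ ∂ₖψ − yⱼ ∫ η ∂ₖψ`. [folklore] -/
theorem integral_remainder₃_eq (hη : Continuous η) (hψ : ContDiff ℝ 1 ψ) (hψc : HasCompactSupport ψ) (y : E3)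
    (j k : Fin 3) :
    ∫ z : E3, η (z + y) * (z j * pd k ψ (z + y)) =
      (∫ x : E3, η x * (x j * pd k ψ x)) - y j * ∫ x : E3, η x * pd k ψ x := by
  have hpc : Continuous (pd k ψ) := (hψ.continuous_fderiv one_ne_zero).clm_apply continuous_const
  have hpcs : HasCompactSupport (pd k ψ) := hasCompactSupport_pd hψc k
  set H : E3 → ℝ := fun x ↦ η x * (x j * pd k ψ x) - y j * (η x * pd k ψ x) with hH
  have h1 : ∫ z : E3, η (z + y) * (z j * pd k ψ (z + y)) = ∫ x : E3, H x := by
    rw [← integral_add_right_eq_self H y]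
    refine integral_congr_ae (ae_of_all _ fun z ↦ ?_)
    simp only [hH, PiLp.add_apply]
    ring
  have I1 : Integrable fun x : E3 ↦ η x * (x j * pd k ψ x) :=
    (hη.mul ((EuclideanSpace.proj (𝕜 := ℝ) j).continuous.mul hpc)).integrable_of_hasCompactSupport
      hpcs.mul_left.mul_left
  have I2 : Integrable fun x : E3 ↦ y j * (η x * pd k ψ x) :=
    ((hη.mul hpc).integrable_of_hasCompactSupport hpcs.mul_left).const_mul _
  rw [h1, hH, integral_sub I1 I2, integral_const_mul]

/-- **The remainder pairing, one pair of indices.** For a density `f ∈ C_c` of zero mass, `ψ ∈ C²_c` and indices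
`j, k`, the `y`-integral of `f(y)` against the right-hand side of `bogovskiiT_weak` (test function `ψ(· + y)`) is
`−δ_{jk} (∫η) ∫ f ψ − ½ δ_{jk} Σ_m (∫ ∂_mη ψ)(∫ y_m f) − ½ (∫ η ∂_kψ)(∫ y_j f)`. [cite: MaoOhTao2023, Lemma 2.3 (T2)] -/
theorem integral_mul_bogovskiiT_remainder_eq (hη : ContDiff ℝ 1 η) {f : E3 → ℝ} (hf : Continuous f)
    (hfc : HasCompactSupport f) (hf0 : ∫ y : E3, f y = 0) (hψ : ContDiff ℝ 2 ψ) (hψc : HasCompactSupport ψ)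
    (j k : Fin 3) :
    ∫ y : E3, f y * (-((if j = k then (1 : ℝ) else 0) * (ψ y * ∫ z : E3, η z)) +
        (if j = k then (1 : ℝ) else 0) *
          (∫ z : E3, ((5 / 2 : ℝ) * η (z + y) + (1 / 2 : ℝ) * ∑ m, z m * pd m η (z + y)) * ψ (z + y)) +
        (1 / 2 : ℝ) * ∫ z : E3, η (z + y) * (z j * pd k ψ (z + y))) =
      -((if j = k then (1 : ℝ) else 0) * ((∫ z : E3, η z) * ∫ y : E3, f y * ψ y)) -
        (1 / 2 : ℝ) * (if j = k then (1 : ℝ) else 0) * (∑ m, (∫ x : E3, pd m η x * ψ x) * ∫ y : E3, y m * f y) -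
        (1 / 2 : ℝ) * ((∫ x : E3, η x * pd k ψ x) * ∫ y : E3, y j * f y) := by
  have hηc : Continuous η := hη.continuous
  have hψ1 : ContDiff ℝ 1 ψ := hψ.of_le one_le_two
  have hpc : ∀ m, Continuous (pd m η) := fun m ↦ (hη.continuous_fderiv one_ne_zero).clm_apply continuous_const
  -- the inner integrals as affine functions of `y`
  have hpt : ∀ y : E3, f y * (-((if j = k then (1 : ℝ) else 0) * (ψ y * ∫ z : E3, η z)) +
      (if j = k then (1 : ℝ) else 0) *
        (∫ z : E3, ((5 / 2 : ℝ) * η (z + y) + (1 / 2 : ℝ) * ∑ m, z m * pd m η (z + y)) * ψ (z + y)) +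
      (1 / 2 : ℝ) * ∫ z : E3, η (z + y) * (z j * pd k ψ (z + y))) =
      -((if j = k then (1 : ℝ) else 0) * ∫ z : E3, η z) * (f y * ψ y) +
        ((if j = k then (1 : ℝ) else 0) * ((5 / 2 : ℝ) * (∫ x : E3, η x * ψ x) +
          (1 / 2 : ℝ) * ∑ m, ∫ x : E3, x m * (pd m η x * ψ x)) +
          (1 / 2 : ℝ) * ∫ x : E3, η x * (x j * pd k ψ x)) * f y -
        ((1 / 2 : ℝ) * (if j = k then (1 : ℝ) else 0)) * (f y * ∑ m, y m * ∫ x : E3, pd m η x * ψ x) -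
        ((1 / 2 : ℝ) * ∫ x : E3, η x * pd k ψ x) * (y j * f y) := by
    intro y
    rw [integral_remainder₂_eq hη hψ.continuous hψc y, integral_remainder₃_eq hηc hψ1 hψc y j k]
    ring
  have hS : Continuous fun y : E3 ↦ ∑ m, y m * ∫ x : E3, pd m η x * ψ x :=
    continuous_finsetSum _ fun m _ ↦ (EuclideanSpace.proj (𝕜 := ℝ) m).continuous.mul continuous_const
  have I1 : Integrable fun y : E3 ↦ -((if j = k then (1 : ℝ) else 0) * ∫ z : E3, η z) * (f y * ψ y) :=
    ((hf.mul hψ.continuous).integrable_of_hasCompactSupport hfc.mul_right).const_mul _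
  have I2 : Integrable fun y : E3 ↦ ((if j = k then (1 : ℝ) else 0) * ((5 / 2 : ℝ) * (∫ x : E3, η x * ψ x) +
      (1 / 2 : ℝ) * ∑ m, ∫ x : E3, x m * (pd m η x * ψ x)) + (1 / 2 : ℝ) * ∫ x : E3, η x * (x j * pd k ψ x)) * f y :=
    (hf.integrable_of_hasCompactSupport hfc).const_mul _
  have I3 : Integrable fun y : E3 ↦ ((1 / 2 : ℝ) * (if j = k then (1 : ℝ) else 0)) *
      (f y * ∑ m, y m * ∫ x : E3, pd m η x * ψ x) :=
    ((hf.mul hS).integrable_of_hasCompactSupport hfc.mul_right).const_mul _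
  have I4 : Integrable fun y : E3 ↦ ((1 / 2 : ℝ) * ∫ x : E3, η x * pd k ψ x) * (y j * f y) :=
    (((EuclideanSpace.proj (𝕜 := ℝ) j).continuous.mul hf).integrable_of_hasCompactSupport hfc.mul_left).const_mul _
  -- `∫ f (Σ_m y_m C_m) = Σ_m C_m ∫ y_m f`
  have Im : ∀ m, Integrable fun y : E3 ↦ (∫ x : E3, pd m η x * ψ x) * (y m * f y) := fun m ↦
    (((EuclideanSpace.proj (𝕜 := ℝ) m).continuous.mul hf).integrable_of_hasCompactSupport hfc.mul_left).const_mul _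
  have hsum : ∫ y : E3, f y * ∑ m, y m * ∫ x : E3, pd m η x * ψ x =
      ∑ m, (∫ x : E3, pd m η x * ψ x) * ∫ y : E3, y m * f y := by
    rw [← Finset.sum_congr rfl fun m _ ↦ integral_const_mul _ _, ← integral_finsetSum _ fun m _ ↦ Im m]
    refine integral_congr_ae (ae_of_all _ fun y ↦ ?_)
    simp only [Finset.mul_sum]
    exact Finset.sum_congr rfl fun m _ ↦ by ring
  have I12 : Integrable fun y : E3 ↦ -((if j = k then (1 : ℝ) else 0) * ∫ z : E3, η z) * (f y * ψ y) +
      ((if j = k then (1 : ℝ) else 0) * ((5 / 2 : ℝ) * (∫ x : E3, η x * ψ x) +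
        (1 / 2 : ℝ) * ∑ m, ∫ x : E3, x m * (pd m η x * ψ x)) + (1 / 2 : ℝ) * ∫ x : E3, η x * (x j * pd k ψ x)) * f y :=
    I1.add I2
  have I123 : Integrable fun y : E3 ↦ -((if j = k then (1 : ℝ) else 0) * ∫ z : E3, η z) * (f y * ψ y) +
      ((if j = k then (1 : ℝ) else 0) * ((5 / 2 : ℝ) * (∫ x : E3, η x * ψ x) +
        (1 / 2 : ℝ) * ∑ m, ∫ x : E3, x m * (pd m η x * ψ x)) + (1 / 2 : ℝ) * ∫ x : E3, η x * (x j * pd k ψ x)) * f y -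
      ((1 / 2 : ℝ) * (if j = k then (1 : ℝ) else 0)) * (f y * ∑ m, y m * ∫ x : E3, pd m η x * ψ x) :=
    I12.sub I3
  rw [integral_congr_ae (ae_of_all _ hpt), integral_sub I123 I4, integral_sub I12 I3, integral_add I1 I2,
    integral_const_mul, integral_const_mul, integral_const_mul, integral_const_mul, hf0, hsum]
  ring

/-- **(T2): the smooth remainder vanishes under the six Killing moment conditions.** Summing the previous pairing
over `j, k` with `f = F^k`, `ψ = ψ_j`, for a vector density `F ∈ C_c` with `∫ F^k = 0` (translations) and
`∫ y_m F^j = ∫ y_j F^m` (rotations) and test fields `ψ_j ∈ C²_c`: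
`Σ_{j,k} ∫ F^k(y) · RHS_{jk}(y) dy = −(∫η) Σ_j ∫ F^j ψ_j` — the `C`–`A` cross terms cancel after the integration by
parts `∫ η ∂_kψ_j = −∫ ∂_kη ψ_j` and the symmetry of `A_{mj} = ∫ y_m F^j`. [cite: MaoOhTao2023, Lemma 2.3 (T2)] -/
theorem sum_sum_integral_mul_bogovskiiT_remainder_eq (hη : ContDiff ℝ 1 η)
    {F : Fin 3 → E3 → ℝ} (hF : ∀ k, Continuous (F k)) (hFc : ∀ k, HasCompactSupport (F k))
    (hF0 : ∀ k, ∫ y : E3, F k y = 0) (hFA : ∀ m j : Fin 3, ∫ y : E3, y m * F j y = ∫ y : E3, y j * F m y)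
    {Ψ : Fin 3 → E3 → ℝ} (hΨ : ∀ j, ContDiff ℝ 2 (Ψ j)) (hΨc : ∀ j, HasCompactSupport (Ψ j)) :
    ∑ j, ∑ k, ∫ y : E3, F k y * (-((if j = k then (1 : ℝ) else 0) * (Ψ j y * ∫ z : E3, η z)) +
        (if j = k then (1 : ℝ) else 0) *
          (∫ z : E3, ((5 / 2 : ℝ) * η (z + y) + (1 / 2 : ℝ) * ∑ m, z m * pd m η (z + y)) * Ψ j (z + y)) +
        (1 / 2 : ℝ) * ∫ z : E3, η (z + y) * (z j * pd k (Ψ j) (z + y))) =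
      -((∫ z : E3, η z) * ∑ j, ∫ y : E3, F j y * Ψ j y) := by
  rw [Finset.sum_congr rfl fun j _ ↦ Finset.sum_congr rfl fun k _ ↦
    integral_mul_bogovskiiT_remainder_eq hη (hF k) (hFc k) (hF0 k) (hΨ j) (hΨc j) j k]
  -- integration by parts: `∫ η ∂_kψ_j = −∫ ∂_kη ψ_j`
  have hD : ∀ j k, ∫ x : E3, η x * pd k (Ψ j) x = -∫ x : E3, pd k η x * Ψ j x := by
    intro j k
    have h := integral_pd_mul_eq_neg ((hΨ j).of_le one_le_two) (hΨc j) hη k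
    calc ∫ x : E3, η x * pd k (Ψ j) x = ∫ x : E3, pd k (Ψ j) x * η x :=
          integral_congr_ae (ae_of_all _ fun x ↦ mul_comm _ _)
      _ = -∫ x : E3, Ψ j x * pd k η x := h
      _ = -∫ x : E3, pd k η x * Ψ j x := by
          rw [integral_congr_ae (ae_of_all _ fun x ↦ mul_comm (Ψ j x) _)]
  simp only [hD, Fin.sum_univ_three, Fin.isValue]
  norm_num [Fin.ext_iff]
  rw [hFA 1 0, hFA 2 0, hFA 2 1]
  ring

/-- The per-`y` identity `bogovskiiT_weak` for the translated test function `z ↦ ψ(z + y)`. [folklore] -/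
theorem bogovskiiT_weak_translate (hη : ContDiff ℝ 1 η) (hR : ∀ z : E3, R < ‖z‖ → η z = 0)
    (hψ : ContDiff ℝ 2 ψ) (hψc : HasCompactSupport ψ) (y : E3) (j k : Fin 3) :
    (if j = k then (1 : ℝ) else 0) *
        ((1 / 2 : ℝ) * (∑ i, ∫ z : E3, bogovskiiWeight η y ‖z‖ (‖z‖⁻¹ • z) * (z i * (‖z‖ ^ 3)⁻¹) *
            pd i ψ (z + y)) -
          (1 / 2 : ℝ) * ∑ i, ∑ m, ∫ z : E3,
            bogovskiiWeight η y ‖z‖ (‖z‖⁻¹ • z) * (z i * (z m * (‖z‖ ^ 3)⁻¹)) * pd m (pd i ψ) (z + y)) +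
      (1 / 2 : ℝ) * (∫ z : E3, bogovskiiWeight η y ‖z‖ (‖z‖⁻¹ • z) * (z j * (‖z‖ ^ 3)⁻¹) * pd k ψ (z + y)) -
      (1 / 2 : ℝ) * (∑ m, ∫ z : E3,
        bogovskiiWeight η y ‖z‖ (‖z‖⁻¹ • z) * (z m * (‖z‖ ^ 3)⁻¹) * (z j * pd m (pd k ψ) (z + y))) +
      ∑ i, ∫ z : E3, bogovskiiWeight η y ‖z‖ (‖z‖⁻¹ • z) * (z i * (‖z‖ ^ 3)⁻¹) * (z j * pd i (pd k ψ) (z + y)) =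
    -((if j = k then (1 : ℝ) else 0) * (ψ y * ∫ z : E3, η z)) +
      (if j = k then (1 : ℝ) else 0) *
        (∫ z : E3, ((5 / 2 : ℝ) * η (z + y) + (1 / 2 : ℝ) * ∑ m, z m * pd m η (z + y)) * ψ (z + y)) +
      (1 / 2 : ℝ) * ∫ z : E3, η (z + y) * (z j * pd k ψ (z + y)) := by
  have hφd : ContDiff ℝ 2 fun z : E3 ↦ ψ (z + y) := hψ.comp (contDiff_id.add contDiff_const)
  have hφc : HasCompactSupport fun z : E3 ↦ ψ (z + y) := hψc.comp_homeomorph (Homeomorph.addRight y)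
  have h := bogovskiiT_weak hη hR hφd hφc y j k
  have h1 : ∀ i, (pd i fun z : E3 ↦ ψ (z + y)) = fun z ↦ pd i ψ (z + y) :=
    fun i ↦ funext fun z ↦ pd_comp_add_const ψ y z i
  simp only [h1, pd_comp_add_const, zero_add] at h
  exact h

/-- **Lemma 2.3, (T2) in weak form (density integrated).** Let `η ∈ C¹_c`, `F ∈ C_c(ℝ³; ℝ³)` with the six Killing
moment conditions `∫ F^k = 0`, `∫ y_m F^j = ∫ y_j F^m`, and `ψ_j ∈ C²_c(ℝ³)`.  Then
`Σ_{j,k} ∫ F^k(y) · Σ_i ⟨(Ψ_η)^{ij}_k(· + y, y), ∂ᵢψ_j(· + y)⟩ dy = −(∫η) Σ_j ∫ F^j ψ_j`,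
i.e. `Σ_{i,j} ⟨(T F)^{ij}, ∂ᵢψ_j⟩ = −(∫η) ⟨F, ψ⟩`: `∂_i (T F)^{ij} = F^j` in `𝒟'` when `∫ η = 1` (the pairing
`⟨(Ψ_η)^{ij}_k, ·⟩` being the divergence-form pairing of `bogovskiiT_weak`, `+`-sign kernel).
[cite: MaoOhTao2023, Lemma 2.3 (T2)] -/
theorem sum_sum_integral_mul_bogovskiiT_weak_eq (hη : ContDiff ℝ 1 η) (hR : ∀ z : E3, R < ‖z‖ → η z = 0)
    {F : Fin 3 → E3 → ℝ} (hF : ∀ k, Continuous (F k)) (hFc : ∀ k, HasCompactSupport (F k))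
    (hF0 : ∀ k, ∫ y : E3, F k y = 0) (hFA : ∀ m j : Fin 3, ∫ y : E3, y m * F j y = ∫ y : E3, y j * F m y)
    {Ψ : Fin 3 → E3 → ℝ} (hΨ : ∀ j, ContDiff ℝ 2 (Ψ j)) (hΨc : ∀ j, HasCompactSupport (Ψ j)) :
    ∑ j, ∑ k, ∫ y : E3, F k y * ((if j = k then (1 : ℝ) else 0) *
        ((1 / 2 : ℝ) * (∑ i, ∫ z : E3, bogovskiiWeight η y ‖z‖ (‖z‖⁻¹ • z) * (z i * (‖z‖ ^ 3)⁻¹) *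
            pd i (Ψ j) (z + y)) -
          (1 / 2 : ℝ) * ∑ i, ∑ m, ∫ z : E3,
            bogovskiiWeight η y ‖z‖ (‖z‖⁻¹ • z) * (z i * (z m * (‖z‖ ^ 3)⁻¹)) * pd m (pd i (Ψ j)) (z + y)) +
      (1 / 2 : ℝ) * (∫ z : E3, bogovskiiWeight η y ‖z‖ (‖z‖⁻¹ • z) * (z j * (‖z‖ ^ 3)⁻¹) * pd k (Ψ j) (z + y)) -
      (1 / 2 : ℝ) * (∑ m, ∫ z : E3,
        bogovskiiWeight η y ‖z‖ (‖z‖⁻¹ • z) * (z m * (‖z‖ ^ 3)⁻¹) * (z j * pd m (pd k (Ψ j)) (z + y))) +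
      ∑ i, ∫ z : E3, bogovskiiWeight η y ‖z‖ (‖z‖⁻¹ • z) * (z i * (‖z‖ ^ 3)⁻¹) *
        (z j * pd i (pd k (Ψ j)) (z + y))) =
      -((∫ z : E3, η z) * ∑ j, ∫ y : E3, F j y * Ψ j y) := by
  refine Eq.trans ?_ (sum_sum_integral_mul_bogovskiiT_remainder_eq hη hF hFc hF0 hFA hΨ hΨc)
  refine Finset.sum_congr rfl fun j _ ↦ Finset.sum_congr rfl fun k _ ↦
    integral_congr_ae (ae_of_all _ fun y ↦ ?_)
  simp only
  rw [bogovskiiT_weak_translate hη hR (hΨ j) (hΨc j) y j k]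

end Remainder

end MaoOhTao

end Literature.Geometry.Lorentzian

end
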